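import Summits.ValiantsHypothesis.ValiantsHypothesis.Theorems.LacunarySymmetroidMatrixDescartesProductPlusOneCloudMonotone

/-!
# LINE (A) `product_plus_one` — brick #17 (E2) CLOUD CONVEXITY: before its pole an unswitched incoherent row's
# `Q = θψ/(p² x^p)` is positive, non-decreasing and convex in `y = x^p` (gap `e₁ ≤ e₂`)
# (`--supports` stmt-ValiantsHypothesis-18050 `MatrixDescartes`; helper lemma of the slow-knee cloud cell, memo §19.1 (E2))

One row `g = A − B x^p − C x^q` (`p = e₁+1`, `q = e₁+e₂+2`, `B, C ≥ 0`, `B + C > 0`) on its window `0 < x`, `g(x) > 0`, in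
the tower currency of ✓ `…CloudDefs` (`ψ₁ = rowPsi1 = θψ`, `ψ₂ = rowPsi2`, `ψ₃ = rowPsi3`; `W(g) = −g²ψ₁` by
✓ `logWronskian_row_eq_rowPsi1`, so the pen's `cloudQ = −W(g)/(p²x^p g²) = ψ₁/(p² x^p)`).  With `y = x^p`
(`θ = p·y·d/dy`): `p³x^{2p}·Q_y = ψ₂ − pψ₁` and `p⁴x^{3p}·Q_yy = ψ₃ − 3pψ₂ + 2p²ψ₁`.  CLEARED-NUMERATOR CERTIFICATES
(`β = Bx^p`, `γ = Cx^q`, `H₁ = pβ + qγ`, `u = 1/g > 0`; crit-1 #188 P1, p5 g16 05:28:38Z):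

* (M)  `ψ₂ − pψ₁ = q²(q−p)γ·u + H₁(2p²β + q(3q−p)γ)·u² + 2H₁³·u³ ≥ 0` (every `p < q`) — `rowPsi2_sub_mul_rowPsi1_eq`,
  ★ `rowPsi2_ge`;
* (Cv) `ψ₃ − 3pψ₂ + 2p²ψ₁ = q²(q−p)(q−2p)γ·u + [pq(4q+p)(q−p)βγ + q²(7q−2p)(q−p)γ²]·u² + 6H₁²(p²β + q(2q−p)γ)·u³ + 6H₁⁴·u⁴`
  (the `β²u²` terms cancel), `≥ 0` as soon as `q ≥ 2p ⟺ e₁ ≤ e₂` — `rowPsi3_sub_eq`, ★ `rowPsi3_convex`;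
* ★ `cloudConvexity` — `0 < ψ₁ ∧ pψ₁ ≤ ψ₂ ∧ 3pψ₂ ≤ ψ₃ + 2p²ψ₁` (the brick E4 imports);
* the pen's x-form (E2 of `scratch19`, without real powers): for `Q x = ψ₁/(p² x^p)` the closed forms
  `Q₁ = (ψ₂ − pψ₁)/(p² x^{p+1})`, `Q₂ = (ψ₃ − (2p+1)ψ₂ + p(p+1)ψ₁)/(p² x^{p+2})` with `HasDerivAt Q (Q₁ x) x`,
  `HasDerivAt Q₁ (Q₂ x) x`, `0 < Q x`, `0 ≤ Q₁ x`, `(p−1)·Q₁ x ≤ x·Q₂ x` — ★ `cloudQ_convexity`.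

The gap hypothesis is load-bearing: for `p < q < 2p` convexity in `y` fails near `0` (pen's numerics).  Honest framing: an input
lemma of ONE cell of LINE (A); `OneChangeFloorK3` / `WronskianBudgetK3` / 18050 / `MatrixDescartes` OPEN; `VP ≠ VNP` NOT proved; no summit
statement is proved here.  No definitions, no named facts. [folklore]
-/

set_option linter.dupNamespace false

namespace Summit.ValiantsHypothesis.ValiantsHypothesis.Theorems.LacunarySymmetroidMatrixDescartes

namespace ProductPlusOne

section Row

variable (e₁ e₂ : ℕ) (A B C : ℝ)

/-- (M), the certificate: `ψ₂ − pψ₁ = q²(q−p)γ·u + H₁(2p²β + q(3q−p)γ)·u² + 2H₁³·u³` (`q − p = e₂ + 1`,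
`3q − p = 2e₁ + 3e₂ + 5`). [folklore] -/
theorem rowPsi2_sub_mul_rowPsi1_eq (x : ℝ) :
    rowPsi2 e₁ e₂ A B C x - ((e₁ : ℝ) + 1) * rowPsi1 e₁ e₂ A B C x =
      ((e₁ : ℝ) + e₂ + 2) ^ 2 * ((e₂ : ℝ) + 1) * (C * x ^ (e₁ + e₂ + 2)) * rowU e₁ e₂ A B C x
      + rowH e₁ e₂ 1 B C x * (2 * ((e₁ : ℝ) + 1) ^ 2 * (B * x ^ (e₁ + 1))
          + ((e₁ : ℝ) + e₂ + 2) * (2 * (e₁ : ℝ) + 3 * e₂ + 5) * (C * x ^ (e₁ + e₂ + 2))) * rowU e₁ e₂ A B C x ^ 2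
      + 2 * rowH e₁ e₂ 1 B C x ^ 3 * rowU e₁ e₂ A B C x ^ 3 := by
  unfold rowPsi1 rowPsi2 rowH
  ring

/-- ★ (M) **`p·θψ ≤ θ²ψ`** before the pole (every `p < q`): the row's `Q = θψ/(p²x^p)` is non-decreasing in `y = x^p`.
[folklore] -/
theorem rowPsi2_ge {x : ℝ} (hx : 0 < x) (hB : 0 ≤ B) (hC : 0 ≤ C)
    (hF : 0 < A - B * x ^ (e₁ + 1) - C * x ^ (e₁ + e₂ + 2)) :
    ((e₁ : ℝ) + 1) * rowPsi1 e₁ e₂ A B C x ≤ rowPsi2 e₁ e₂ A B C x := by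
  have hu := rowU_pos e₁ e₂ A B C hF
  have h1 := rowH_nonneg e₁ e₂ B C 1 hx hB hC
  rw [← sub_nonneg, rowPsi2_sub_mul_rowPsi1_eq]
  positivity

/-- (Cv), the certificate under the gap `e₂ = e₁ + d`: `ψ₃ − 3pψ₂ + 2p²ψ₁ = q²(q−p)(q−2p)γ·u + [pq(4q+p)(q−p)βγ +
q²(7q−2p)(q−p)γ²]·u² + 6H₁²(p²β + q(2q−p)γ)·u³ + 6H₁⁴·u⁴` (`q − 2p = d`, `4q + p = 5e₁ + 4e₂ + 9`,
`7q − 2p = 5e₁ + 7e₂ + 12`, `2q − p = e₁ + 2e₂ + 3`; the `β²u²` terms cancel). [folklore] -/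
theorem rowPsi3_sub_eq (d : ℕ) (x : ℝ) :
    rowPsi3 e₁ (e₁ + d) A B C x - 3 * ((e₁ : ℝ) + 1) * rowPsi2 e₁ (e₁ + d) A B C x
        + 2 * ((e₁ : ℝ) + 1) ^ 2 * rowPsi1 e₁ (e₁ + d) A B C x =
      ((e₁ : ℝ) + ((e₁ + d : ℕ) : ℝ) + 2) ^ 2 * ((((e₁ + d : ℕ) : ℝ)) + 1) * (d : ℝ) * (C * x ^ (e₁ + (e₁ + d) + 2))
          * rowU e₁ (e₁ + d) A B C x
      + (((e₁ : ℝ) + 1) * ((e₁ : ℝ) + ((e₁ + d : ℕ) : ℝ) + 2) * (5 * (e₁ : ℝ) + 4 * ((e₁ + d : ℕ) : ℝ) + 9)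
            * ((((e₁ + d : ℕ) : ℝ)) + 1) * (B * x ^ (e₁ + 1)) * (C * x ^ (e₁ + (e₁ + d) + 2))
          + ((e₁ : ℝ) + ((e₁ + d : ℕ) : ℝ) + 2) ^ 2 * (5 * (e₁ : ℝ) + 7 * ((e₁ + d : ℕ) : ℝ) + 12)
            * ((((e₁ + d : ℕ) : ℝ)) + 1) * (C * x ^ (e₁ + (e₁ + d) + 2)) ^ 2) * rowU e₁ (e₁ + d) A B C x ^ 2
      + 6 * rowH e₁ (e₁ + d) 1 B C x ^ 2 * (((e₁ : ℝ) + 1) ^ 2 * (B * x ^ (e₁ + 1))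
          + ((e₁ : ℝ) + ((e₁ + d : ℕ) : ℝ) + 2) * ((e₁ : ℝ) + 2 * ((e₁ + d : ℕ) : ℝ) + 3) * (C * x ^ (e₁ + (e₁ + d) + 2)))
          * rowU e₁ (e₁ + d) A B C x ^ 3
      + 6 * rowH e₁ (e₁ + d) 1 B C x ^ 4 * rowU e₁ (e₁ + d) A B C x ^ 4 := by
  unfold rowPsi1 rowPsi2 rowPsi3 rowH
  push_cast
  ring

/-- ★ (Cv) **`3p·θ²ψ ≤ θ³ψ + 2p²·θψ`** before the pole, under the gap `e₁ ≤ e₂` (`⟺ 2p ≤ q`): the row's `Q` is CONVEX in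
`y = x^p`. [folklore] -/
theorem rowPsi3_convex (he : e₁ ≤ e₂) {x : ℝ} (hx : 0 < x) (hB : 0 ≤ B) (hC : 0 ≤ C)
    (hF : 0 < A - B * x ^ (e₁ + 1) - C * x ^ (e₁ + e₂ + 2)) :
    3 * ((e₁ : ℝ) + 1) * rowPsi2 e₁ e₂ A B C x ≤
      rowPsi3 e₁ e₂ A B C x + 2 * ((e₁ : ℝ) + 1) ^ 2 * rowPsi1 e₁ e₂ A B C x := by
  obtain ⟨d, rfl⟩ := Nat.exists_eq_add_of_le he
  have hu := rowU_pos e₁ (e₁ + d) A B C hF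
  have h1 := rowH_nonneg e₁ (e₁ + d) B C 1 hx hB hC
  have h : 0 ≤ rowPsi3 e₁ (e₁ + d) A B C x - 3 * ((e₁ : ℝ) + 1) * rowPsi2 e₁ (e₁ + d) A B C x
      + 2 * ((e₁ : ℝ) + 1) ^ 2 * rowPsi1 e₁ (e₁ + d) A B C x := by
    rw [rowPsi3_sub_eq]
    positivity
  linarith

/-- ★ **CLOUD CONVEXITY** (brick #17 (E2) in tower currency): for an unswitched incoherent row with the gap `e₁ ≤ e₂`, before its
pole `θψ > 0`, `p·θψ ≤ θ²ψ` and `3p·θ²ψ ≤ θ³ψ + 2p²·θψ` — i.e. `Q(y) = θψ(y^{1/p})/(p²y)` is positive, non-decreasing and convex.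
[folklore] -/
theorem cloudConvexity (he : e₁ ≤ e₂) {x : ℝ} (hx : 0 < x) (hB : 0 ≤ B) (hC : 0 ≤ C) (hBC : 0 < B + C)
    (hF : 0 < A - B * x ^ (e₁ + 1) - C * x ^ (e₁ + e₂ + 2)) :
    0 < rowPsi1 e₁ e₂ A B C x ∧
      ((e₁ : ℝ) + 1) * rowPsi1 e₁ e₂ A B C x ≤ rowPsi2 e₁ e₂ A B C x ∧
      3 * ((e₁ : ℝ) + 1) * rowPsi2 e₁ e₂ A B C x ≤
        rowPsi3 e₁ e₂ A B C x + 2 * ((e₁ : ℝ) + 1) ^ 2 * rowPsi1 e₁ e₂ A B C x :=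
  ⟨(rowPsi_signs e₁ e₂ A B C hx hB hC hBC hF).2.1, rowPsi2_ge e₁ e₂ A B C hx hB hC hF,
    rowPsi3_convex e₁ e₂ A B C he hx hB hC hF⟩

/-! ### The pen's x-form: `Q = θψ/(p² x^p)` with closed-form first and second derivatives -/

/-- **First derivative of `Q = ψ₁/(p² x^p)`**: `Q′ = (ψ₂ − pψ₁)/(p² x^{p+1})`. [folklore] -/
theorem hasDerivAt_cloudQ {x : ℝ} (hx : 0 < x) (hF : A - B * x ^ (e₁ + 1) - C * x ^ (e₁ + e₂ + 2) ≠ 0) :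
    HasDerivAt (fun t => rowPsi1 e₁ e₂ A B C t / (((e₁ : ℝ) + 1) ^ 2 * t ^ (e₁ + 1)))
      ((rowPsi2 e₁ e₂ A B C x - ((e₁ : ℝ) + 1) * rowPsi1 e₁ e₂ A B C x) /
        (((e₁ : ℝ) + 1) ^ 2 * x ^ (e₁ + 2))) x := by
  have hx0 : x ≠ 0 := hx.ne'
  have hp : ((e₁ : ℝ) + 1) ≠ 0 := by positivity
  have h1 := hasDerivAt_rowPsi1 e₁ e₂ A B C hx0 hF
  have h2 : HasDerivAt (fun t : ℝ => ((e₁ : ℝ) + 1) ^ 2 * t ^ (e₁ + 1))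
      (((e₁ : ℝ) + 1) ^ 2 * (((e₁ + 1 : ℕ) : ℝ) * x ^ (e₁ + 1 - 1))) x :=
    (hasDerivAt_pow (e₁ + 1) x).const_mul _
  have hden : ((e₁ : ℝ) + 1) ^ 2 * x ^ (e₁ + 1) ≠ 0 := by positivity
  have hfun : (fun t => rowPsi1 e₁ e₂ A B C t / (((e₁ : ℝ) + 1) ^ 2 * t ^ (e₁ + 1))) =
      (rowPsi1 e₁ e₂ A B C / fun t => ((e₁ : ℝ) + 1) ^ 2 * t ^ (e₁ + 1)) := rfl
  rw [hfun]
  refine (h1.div h2 hden).congr_deriv ?_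
  simp only [Nat.add_sub_cancel]
  push_cast
  field_simp
  ring

/-- **Second derivative**: `Q″ = (ψ₃ − (2p+1)ψ₂ + p(p+1)ψ₁)/(p² x^{p+2})`. [folklore] -/
theorem hasDerivAt_cloudQ_deriv {x : ℝ} (hx : 0 < x) (hF : A - B * x ^ (e₁ + 1) - C * x ^ (e₁ + e₂ + 2) ≠ 0) :
    HasDerivAt (fun t => (rowPsi2 e₁ e₂ A B C t - ((e₁ : ℝ) + 1) * rowPsi1 e₁ e₂ A B C t) /
        (((e₁ : ℝ) + 1) ^ 2 * t ^ (e₁ + 2)))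
      ((rowPsi3 e₁ e₂ A B C x - (2 * ((e₁ : ℝ) + 1) + 1) * rowPsi2 e₁ e₂ A B C x
          + ((e₁ : ℝ) + 1) * ((e₁ : ℝ) + 2) * rowPsi1 e₁ e₂ A B C x) /
        (((e₁ : ℝ) + 1) ^ 2 * x ^ (e₁ + 3))) x := by
  have hx0 : x ≠ 0 := hx.ne'
  have hp : ((e₁ : ℝ) + 1) ≠ 0 := by positivity
  have h1 := hasDerivAt_rowPsi1 e₁ e₂ A B C hx0 hF
  have h2 := hasDerivAt_rowPsi2 e₁ e₂ A B C hx0 hF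
  have hnum : HasDerivAt (fun t => rowPsi2 e₁ e₂ A B C t - ((e₁ : ℝ) + 1) * rowPsi1 e₁ e₂ A B C t)
      (rowPsi3 e₁ e₂ A B C x / x - ((e₁ : ℝ) + 1) * (rowPsi2 e₁ e₂ A B C x / x)) x :=
    h2.sub (h1.const_mul _)
  have hden' : HasDerivAt (fun t : ℝ => ((e₁ : ℝ) + 1) ^ 2 * t ^ (e₁ + 2))
      (((e₁ : ℝ) + 1) ^ 2 * (((e₁ + 2 : ℕ) : ℝ) * x ^ (e₁ + 2 - 1))) x :=
    (hasDerivAt_pow (e₁ + 2) x).const_mul _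
  have hden : ((e₁ : ℝ) + 1) ^ 2 * x ^ (e₁ + 2) ≠ 0 := by positivity
  have hfun : (fun t => (rowPsi2 e₁ e₂ A B C t - ((e₁ : ℝ) + 1) * rowPsi1 e₁ e₂ A B C t) /
      (((e₁ : ℝ) + 1) ^ 2 * t ^ (e₁ + 2))) =
      ((fun t => rowPsi2 e₁ e₂ A B C t - ((e₁ : ℝ) + 1) * rowPsi1 e₁ e₂ A B C t) /
        fun t => ((e₁ : ℝ) + 1) ^ 2 * t ^ (e₁ + 2)) := rfl
  rw [hfun]
  refine (hnum.div hden' hden).congr_deriv ?_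
  rw [show e₁ + 2 - 1 = e₁ + 1 from rfl]
  push_cast
  field_simp
  ring

/-- ★ **The pen's (E2) in x-form** (no real powers): on the window, `Q = θψ/(p²x^p)` has `Q > 0`, `Q′ ≥ 0` and
`(p − 1)·Q′ ≤ x·Q″` with the closed forms `Q′ = (ψ₂ − pψ₁)/(p²x^{p+1})`, `Q″ = (ψ₃ − (2p+1)ψ₂ + p(p+1)ψ₁)/(p²x^{p+2})`
(`x·Q″ − (p−1)·Q′ = (ψ₃ − 3pψ₂ + 2p²ψ₁)/(p²x^{p+1})`). [folklore] -/
theorem cloudQ_convexity (he : e₁ ≤ e₂) {x : ℝ} (hx : 0 < x) (hB : 0 ≤ B) (hC : 0 ≤ C) (hBC : 0 < B + C)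
    (hF : 0 < A - B * x ^ (e₁ + 1) - C * x ^ (e₁ + e₂ + 2)) :
    0 < rowPsi1 e₁ e₂ A B C x / (((e₁ : ℝ) + 1) ^ 2 * x ^ (e₁ + 1)) ∧
      0 ≤ (rowPsi2 e₁ e₂ A B C x - ((e₁ : ℝ) + 1) * rowPsi1 e₁ e₂ A B C x) /
        (((e₁ : ℝ) + 1) ^ 2 * x ^ (e₁ + 2)) ∧
      (((e₁ : ℝ) + 1) - 1) * ((rowPsi2 e₁ e₂ A B C x - ((e₁ : ℝ) + 1) * rowPsi1 e₁ e₂ A B C x) /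
          (((e₁ : ℝ) + 1) ^ 2 * x ^ (e₁ + 2))) ≤
        x * ((rowPsi3 e₁ e₂ A B C x - (2 * ((e₁ : ℝ) + 1) + 1) * rowPsi2 e₁ e₂ A B C x
            + ((e₁ : ℝ) + 1) * ((e₁ : ℝ) + 2) * rowPsi1 e₁ e₂ A B C x) /
          (((e₁ : ℝ) + 1) ^ 2 * x ^ (e₁ + 3))) := by
  obtain ⟨h0, hM, hCv⟩ := cloudConvexity e₁ e₂ A B C he hx hB hC hBC hF
  have hp : 0 < ((e₁ : ℝ) + 1) := by positivity
  have hx1 : 0 < x ^ (e₁ + 1) := pow_pos hx _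
  have hx2 : 0 < x ^ (e₁ + 2) := pow_pos hx _
  have hx3 : 0 < x ^ (e₁ + 3) := pow_pos hx _
  refine ⟨by positivity, div_nonneg (sub_nonneg.2 hM) (by positivity), ?_⟩
  rw [mul_div_assoc', mul_div_assoc', div_le_div_iff₀ (by positivity) (by positivity)]
  have hx23 : x ^ (e₁ + 3) = x ^ (e₁ + 2) * x := by ring
  rw [hx23]
  have key : x * (rowPsi3 e₁ e₂ A B C x - (2 * ((e₁ : ℝ) + 1) + 1) * rowPsi2 e₁ e₂ A B C x
      + ((e₁ : ℝ) + 1) * ((e₁ : ℝ) + 2) * rowPsi1 e₁ e₂ A B C x) * (((e₁ : ℝ) + 1) ^ 2 * x ^ (e₁ + 2))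
      - (((e₁ : ℝ) + 1) - 1) * (rowPsi2 e₁ e₂ A B C x - ((e₁ : ℝ) + 1) * rowPsi1 e₁ e₂ A B C x)
        * (((e₁ : ℝ) + 1) ^ 2 * (x ^ (e₁ + 2) * x))
      = (((e₁ : ℝ) + 1) ^ 2 * x ^ (e₁ + 2) * x) *
        (rowPsi3 e₁ e₂ A B C x + 2 * ((e₁ : ℝ) + 1) ^ 2 * rowPsi1 e₁ e₂ A B C x
          - 3 * ((e₁ : ℝ) + 1) * rowPsi2 e₁ e₂ A B C x) := by ring
  have hpos : 0 ≤ (((e₁ : ℝ) + 1) ^ 2 * x ^ (e₁ + 2) * x) *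
      (rowPsi3 e₁ e₂ A B C x + 2 * ((e₁ : ℝ) + 1) ^ 2 * rowPsi1 e₁ e₂ A B C x
        - 3 * ((e₁ : ℝ) + 1) * rowPsi2 e₁ e₂ A B C x) :=
    mul_nonneg (by positivity) (by linarith)
  linarith [key, hpos]

end Row

end ProductPlusOne

end Summit.ValiantsHypothesis.ValiantsHypothesis.Theorems.LacunarySymmetroidMatrixDescartes
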